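import Mathlib
import Literature.MathematicalPhysics.QuantumFieldTheory.Balaban1983to89.TreeLengthCubeSystem

/-!
# `Balaban1983to89.TreeLengthTorus` — the PERIODIC (torus) index model of the cubes π_j and of the localization
domains 𝐃_j, the linear size d_j on the torus, and the discharge of the geometric inputs of `…B12TreeDecay`
((1.26), `hTree`, (2.29), degree bound, volume leaf, cube count) on the papers' own periodic carrier

CITATION HEADER (lean-in-tree rule 2026-08-18).  Sources under audit: T. Bałaban, *Renormalization group approach to
lattice gauge field theories. I*, Commun. Math. Phys. **109**, 249–301 (1987) [Balaban1987RG1] (cell paper B12;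
p. 251 = PDF p. 3, p. 257 = PDF p. 9); *II. Cluster expansions*, Commun. Math. Phys. **116**, 1–22 (1988)
[Balaban1988RG2Cluster] (cell paper B13; (1.26) p. 8, (2.29)–(2.30) p. 18).  Published input whose mechanism the
imported module `…TreeLength` re-proves: J. Dimock, *The renormalization group according to Balaban. II. Large
fields*, J. Math. Phys. **54** (2013) 092301 [Dimock2013BalabanII], App. E Lemma E.1.  Quoted afresh here (p. 257,
render `1987-cmp109-rg-I-small-field-p009`): the sentences fixing the carrier as the (continuum) TORUS and the cube
count of (0.26); everything else this module touches is quoted verbatim in the docstrings of the imported modules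
`…Balaban1983to89.TreeLength` (unit pv22: `cube`, `carrier`, `len`, `Admissible`, `treeLen`, `adjoin_step`,
`card_le_of_sAdmissible_len`), `…Balaban1983to89.TreeLengthCubeSystem` (unit pv22: the WINDOW model `sys`,
`cubeSys`, `degreeLE`, `volumeLeaf`), `…Balaban1983to89.B12TreeDecay` (unit pv03: `CubeSystem`, `DegreeLE`,
`VolumeLeaf`, `Ineq126Printed`, `ineq126_of_volumeLeaf`, `hTree_of_volumeLeaf`, `ineq229_of_volumeLeaf`,
`uvStable030_of_thm1_of_volumeLeaf`), `…Balaban1983to89.B13ScaleTransfer` (unit pv11: `Pt`, `Adj`, `Linked`,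
`FaceConnected`) and `…Balaban1983to89.Setup` (`Params.sitesPerDir`, `Site` = `Fin d → ZMod (sitesPerDir j)`,
`LocDomainSys`).  Cell records: DIVERGENCE D-pv22.3 (window versus torus — the divergence this module lifts),
D-pv22.1 (conventions of `treeLen`, kept), F5; GAPS.md G-B13-04, G-B13-07, G-pv03-1, C-pv22-2, C-pv22-4; unit
`b2b-balaban-pv22` gen 2 (surge node prover #22), journal claim TORUS-TREELEN-KERNEL.  Nothing existing is modified.

WHAT THE PAPER PRINTS.  [Balaban1987RG1] p. 257, verbatim: *"Let us take a nonnegative integer j, and the continuous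
space T scaled properly, so that it corresponds to the lattice T_ξ, ξ = L^{−j}. We decompose the space T into the
lattice of closed cubes of a size M, where M = L^m, with centers at points of the lattice T_M^{(j+m)}. … We denote
this family of cubes by π_j"*; the space T is the TORUS of p. 251, verbatim: *"a torus T obtained by the usual
identification of boundary points of the cube {x ∈ R^d : −L_μ ≦ x_μ ≦ L_μ, μ = 1, …, d}"* (lattice approximations
(0.1)), so π_j is a periodic d-dimensional array of cubes and "common wall" includes the wrap-around walls; *"Such a domain is a union of
a connected, finite family of cubes from π_j. A connected family means that for every pair □, □′ of cubes from the
family there exists a sequence □, □₁, …, □_n, □′ of cubes belonging to the family and such that two consecutive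
cubes have a common wall"*; *"Consider a class of tree graphs contained in X and intersecting all the cubes in X. A
length of a shortest graph in this class, divided by M, is the linear size of X, and is denoted by d_j(X). … Let us
stress the fact that we consider graphs in the continuous space."*; and the cube count in (0.26) p. 257, verbatim:
*"≦ Σ_{j=1}^{k} Σ_{□∈π_j} E₀O(1) = Σ_{j=1}^{k} E₀O(1)M^{−4}|T_1^{(j)}| ≦ E₀O(1)M^{−4}|T_1^{(k)}|η^{−4}, η = L^{−k}"*
(i.e. |π_j| = M^{−4}|T_1^{(j)}| and |T_1^{(j)}| = L^{4(k−j)}|T_1^{(k)}|).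

WHAT IS PROVED HERE (kernel-checked; Mathlib + the imported cell modules only).  Part 1 — the PERIODIC INDEX MODEL the
cell lacked (DIVERGENCE D-pv22.3: *"the torus adjacency (wrap-around) is not formalised anywhere in the cell"*): cubes
of the torus with N cubes per direction = `TPt d N := Fin d → ZMod N` (the shape of `Setup.Site`), the covering
projection `proj : ℤ^d → (ℤ/N)^d`, torus wall-adjacency `TAdj` (x̄ ~ x̄ ± e_i mod N), chains `TLinked`, torus
localization domains `TFaceConnected`; adjacency descends (`proj_adj`) and LIFTS (`exists_lift_adj`: a torus
wall-neighbour of proj x is the projection of a wall-neighbour of x), face-connected families of ℤ^d project to torus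
domains (`tFaceConnected_image`), frontier cubes exist (`exists_tfrontier`).  Part 2 — d_j ON THE TORUS, in the
universal cover: `liftCubes X̄` = ⋃ of the unit cubes of ℝ^d whose index projects into X̄ (= π⁻¹ of the union of the
cubes of X̄); a graph is `TAdmissible` for X̄ iff it is a connected polygonal graph of ℝ^d contained in `liftCubes X̄`
meeting at least one lift of every cube of X̄; `torusTreeLen X̄` := inf of their lengths (READING, recorded as
DIVERGENCE D-pv22g2.1: a tree graph in the torus is simply connected, hence is the isometric image under the covering
map ℝ^d → ℝ^d/Nℤ^d of a tree graph of ℝ^d contained in π⁻¹(X) and meeting π⁻¹(□) for every cube □ of X; conversely a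
connected graph of ℝ^d projects onto a connected graph of the torus of at most the same length, inside X and meeting
all its cubes; with convention (ii) of D-pv22.1 — connected polygonal graphs in place of tree graphs, same infimum —
`torusTreeLen` is the printed d_j of the periodic carrier, up to conventions (i), (iii) of D-pv22.1).  Part 3 — (2.30)
UPPER HALF on the torus, PROVED: every torus localization domain X̄ has a `TAdmissible` graph of length ≤ |X̄| − 1
(`exists_tAdmissible`: greedy LIFT of X̄ cube by cube along frontier walls to a face-connected family of ℤ^d, growing
an admissible graph by `TreeLength.adjoin_step`), hence `torusTreeLen_le_card_sub_one`; and the projection of a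
window domain has torus size ≤ its window size (`torusTreeLen_image_le_treeLen`).  Part 4 — (2.30) LOWER HALF
(repaired, additive form of cell GAPS.md G-B13-07) on the torus, PROVED: |X̄| ≤ 2^d (4 d_j(X̄) + 1)
(`card_le_torusTreeLen`; one chosen met lift per cube of X̄ is a family of |X̄| DISTINCT cubes of ℝ^d for which the
graph is Steiner-admissible, then `TreeLength.card_le_of_sAdmissible_len`).  Part 5 — the torus catalogue as a
`LocDomainSys` (`tsys d N`: domains = non-empty torus-face-connected families, d_j := `torusTreeLen`) and a
`B12TreeDecay.CubeSystem` (`tcubeSys d N`: cubes = `TPt d N`, adjacency = `TAdj`), with `tdegreeLE :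
DegreeLE (2d)` and THE VOLUME LEAF `tvolumeLeaf : VolumeLeaf (4·2^d)` PROVED; hence, by pure application of unit
pv03's theorems, ON THE PERIODIC CARRIER: (1.26) `ineq126_torus` (spelled out over plain finite sets as
`sum_exp_torusTreeLen_le`), the silent input `hTree` of [I] (0.26)/(0.30) (`hTree_torus`, `hTree_scales_torus`), and
(2.29) `ineq229_torus` / `ineq229_torus_unit` — same dimension-only constants κ₀(4·2^d, 2d), K₀(4·2^d, 2d) as the
window model.  Part 6 — the COUNTS: |π_j| = N^d (`card_tcube`), = M^{−d}(MN)^d (`card_tcube_eq_inv_pow`, the shape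
of the input `hπ` of `B12TreeDecay.uvStable030_of_thm1_of_volumeLeaf`), the site-count identity of the periodic
lattices of `Setup` |T^{(j)}| per direction = L^{k−j}·|T^{(k)}| per direction for j ≤ k ≤ m + K
(`sitesPerDir_eq_pow_mul`, `sitesPerDir_pow_eq`, the shape of `hSites`), and the corollary
`uvStable030_of_thm1_torus`: `B12TreeDecay.uvStable030_of_thm1_of_volumeLeaf` at d = 4 with the domain systems
𝐃_j := `tsys 4 (N P j)` — its inputs `hΔ`, `hV` DISCHARGED by Part 5 and `hπ` REPLACED by the tiling identity
|T_1^{(j)}| = (M·N_j)^4 (M·N_j sites per direction) — leaving Theorem 1, the three readings of `Repr` and the two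
site-count identities as the only hypotheses of ultraviolet stability (0.30) in this chain.

WHAT IS *NOT* CLAIMED.  (i) The identification of `torusTreeLen` with the printed d_j rests on the covering-space
READING of Part 2 (D-pv22g2.1) and on conventions (i)–(iii) of D-pv22.1; the torus itself (a quotient metric space)
is not constructed — all geometry is done in the universal cover ℝ^d.  (ii) The cubes are the unit cubes [x, x+1]^d,
x ∈ ℤ^d, of the rescaled picture (p. 257 *"we rescale the space, so that cubes from π_j become unit cubes"*); their
centres x + ½Σe_μ are the points of the centre lattice, as printed (p. 251: *"regular lattices of cubes with corners
at points of L^{−n}Z^d … a lattice of centers of these cubes"*, p. 257: *"with centers at points of the lattice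
T_M^{(j+m)}"*; M = L^{m'} and T_M^{(j+m')} in the vocabulary of NOTATION.md §2.4, which renames the printed exponent
to avoid the clash with L_μ = L^m).  (iii) For N = 1, 2 the torus adjacency
degenerates (x̄ + e_i = x̄ − e_i when N = 2); all statements remain true as stated (upper bounds), nothing special is
claimed there.  (iv) The (2.27) gluing bound, the coarsening/scale-transfer leaves of `…B13ScaleTransfer` and the
polymer-geometry structure `B13Resummation.Geometry` are NOT redone on the torus here (they stay proved for the window
model only, `…TreeLength` Parts 3–4, `…TreeLengthCubeSystem` Part 4).  (v) `uvStable030_of_thm1_torus` keeps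
Theorem 1 (`B12.Thm1Printed`), the readings `h023`, `h028`, `h029` and the site counts `hnum`, `hSites` as displayed
hypotheses exactly as surge node T09.1 does; whether a given `B12.Construction` has numSites j = (M·N_j)^4 is a
property of that construction, not proved here.  Value = kernel-checked bookkeeping (index model + leaf discharge on
the periodic carrier; lifts DIVERGENCE D-pv22.3 from the geometric side of the T09.1 chain), NOT summit progress.
-/

namespace Literature.MathematicalPhysics.QuantumFieldTheory.Balaban1983to89.TreeLengthTorus

noncomputable section

open Literature.MathematicalPhysics.QuantumFieldTheory.Balaban1983to89
open Literature.MathematicalPhysics.QuantumFieldTheory.Balaban1983to89.B13ScaleTransfer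
open Literature.MathematicalPhysics.QuantumFieldTheory.Balaban1983to89.TreeLength
open Literature.MathematicalPhysics.QuantumFieldTheory.Balaban1983to89.B12TreeDecay
open Literature.Probability.LatticeModels (IsRConnected)

variable {d : ℕ} {N : ℕ}

/-! ## Part 1. The periodic index model: cubes of the torus, the covering projection, wall adjacency, domains -/

/-- The cubes of π_j on the TORUS with N cubes per direction, indexed by (ℤ/N)^d — [Balaban1987RG1] p. 257, verbatim:
*"We decompose the space T into the lattice of closed cubes of a size M, where M = L^m, with centers at points of the
lattice T_M^{(j+m)}. … We denote this family of cubes by π_j"* (T the torus of p. 251, verbatim: *"a torus T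
obtained by the usual identification of boundary points of the cube {x ∈ R^d : −L_μ ≦ x_μ ≦ L_μ, μ = 1, …, d}"*;
same shape as `Setup.Site P j = Fin P.d → ZMod (P.sitesPerDir j)`). [cite: Balaban1987RG1, p.257 (localization domains)] -/
abbrev TPt (d N : ℕ) := Fin d → ZMod N

/-- The covering projection ℤ^d → (ℤ/N)^d on cube indices (reduction mod N coordinatewise). [folklore] -/
def proj (N : ℕ) (x : Pt d) : TPt d N := fun i => ((x i : ℤ) : ZMod N)

/-- `proj` coordinatewise. [folklore] -/
@[simp] theorem proj_apply (N : ℕ) (x : Pt d) (i : Fin d) : proj N x i = ((x i : ℤ) : ZMod N) := rfl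

/-- `proj` commutes with updating one coordinate. [folklore] -/
theorem proj_update (N : ℕ) (x : Pt d) (i : Fin d) (v : ℤ) :
    proj N (Function.update x i v) = Function.update (proj N x) i (v : ZMod N) := by
  funext j
  by_cases hj : j = i
  · subst hj
    simp [proj]
  · simp [proj, Function.update_of_ne hj]

/-- TORUS WALL ADJACENCY: two cubes of the torus have a common wall iff their indices differ by a unit vector mod N,
ȳ = x̄ ± e_i — [Balaban1987RG1] p. 257, verbatim: *"two consecutive cubes have a common wall, i.e. their intersection
is a d−1-dimensional cube"*, on the periodic carrier (wrap-around walls included; the shape of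
`B13ScaleTransfer.Adj` with ℤ replaced by ℤ/N). [cite: Balaban1987RG1, p.257 (localization domains)] -/
def TAdj (a b : TPt d N) : Prop :=
  ∃ i : Fin d, b = Function.update a i (a i + 1) ∨ a = Function.update b i (b i + 1)

/-- Torus wall adjacency is symmetric. [folklore] -/
theorem TAdj.symm {a b : TPt d N} (h : TAdj a b) : TAdj b a := by
  obtain ⟨i, h | h⟩ := h
  · exact ⟨i, Or.inr h⟩
  · exact ⟨i, Or.inl h⟩

/-- The cube x̄ + e_i (mod N) has a common wall with x̄. [folklore] -/
theorem tadj_update_add_one (a : TPt d N) (i : Fin d) : TAdj a (Function.update a i (a i + 1)) :=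
  ⟨i, Or.inl rfl⟩

/-- The cube x̄ − e_i (mod N) has a common wall with x̄. [folklore] -/
theorem tadj_update_sub_one (a : TPt d N) (i : Fin d) : TAdj a (Function.update a i (a i - 1)) := by
  refine ⟨i, Or.inr ?_⟩
  simp [Function.update_idem]

/-- The 2d candidate wall-neighbours of a cube x̄ of the torus: x̄ ± e_i (mod N). [folklore] -/
def tshift (a : TPt d N) (p : Fin d × Bool) : TPt d N :=
  Function.update a p.1 (a p.1 + if p.2 then 1 else -1)

/-- Every torus wall-neighbour of x̄ is one of the 2d shifts x̄ ± e_i. [folklore] -/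
theorem exists_tshift_of_tadj {a b : TPt d N} (h : TAdj a b) : ∃ p : Fin d × Bool, b = tshift a p := by
  obtain ⟨i, h | h⟩ := h
  · exact ⟨(i, true), by simp [tshift, h]⟩
  · refine ⟨(i, false), ?_⟩
    funext j
    by_cases hj : j = i
    · subst hj
      have := congrFun h j
      simp only [Function.update_self] at this
      simp only [tshift, Function.update_self, Bool.false_eq_true, ↓reduceIte]
      rw [this]
      abel
    · have := congrFun h j
      simp only [Function.update_of_ne hj] at this
      simp only [tshift, Function.update_of_ne hj]
      exact this.symm

/-- Adjacency DESCENDS: wall-neighbours of ℤ^d project to wall-neighbours of the torus. [folklore] -/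
theorem proj_adj {x y : Pt d} (h : Adj x y) : TAdj (proj N x) (proj N y) := by
  obtain ⟨i, h | h⟩ := h
  · subst h
    refine ⟨i, Or.inl ?_⟩
    rw [proj_update]
    simp
  · subst h
    refine ⟨i, Or.inr ?_⟩
    rw [proj_update]
    simp

/-- Adjacency LIFTS: a torus wall-neighbour of proj x is the projection of a wall-neighbour of x in ℤ^d (the
covering map is a local isomorphism of the cube adjacency graphs). [folklore] -/
theorem exists_lift_adj {x : Pt d} {b : TPt d N} (h : TAdj (proj N x) b) :
    ∃ y : Pt d, proj N y = b ∧ Adj x y := by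
  obtain ⟨i, h | h⟩ := h
  · refine ⟨Function.update x i (x i + 1), ?_, adj_update_add_one x i⟩
    rw [h, proj_update]
    simp
  · refine ⟨Function.update x i (x i - 1), ?_, adj_update_sub_one x i⟩
    rw [proj_update]
    funext j
    by_cases hj : j = i
    · subst hj
      have hi := congrFun h j
      simp only [Function.update_self, proj_apply] at hi
      simp only [Function.update_self]
      push_cast
      rw [hi]
      abel
    · have hj' := congrFun h j
      simp only [Function.update_of_ne hj, proj_apply] at hj'
      simp only [Function.update_of_ne hj, proj_apply]
      exact hj'

/-- One step of a chain of cubes of the torus inside the family S̄ (both cubes in S̄, common wall) — the shape of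
`B13ScaleTransfer.StepIn`. [cite: Balaban1987RG1, p.257 (localization domains)] -/
def TStepIn (S : Finset (TPt d N)) (a b : TPt d N) : Prop := a ∈ S ∧ b ∈ S ∧ TAdj a b

/-- Chain-connectedness of two cubes of the torus inside S̄ (reflexive–transitive closure of `TStepIn S̄`). [cite: Balaban1987RG1, p.257 (localization domains)] -/
def TLinked (S : Finset (TPt d N)) : TPt d N → TPt d N → Prop := Relation.ReflTransGen (TStepIn S)

/-- TORUS LOCALIZATION DOMAINS (connectedness): [Balaban1987RG1] p. 257, verbatim: *"A connected family means that
for every pair □, □′ of cubes from the family there exists a sequence □, □₁, …, □_n, □′ of cubes belonging to the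
family and such that two consecutive cubes have a common wall"*, for families of cubes OF THE TORUS (the papers'
carrier; `B13ScaleTransfer.FaceConnected` is the same sentence for the window model). [cite: Balaban1987RG1, p.257 (localization domains)] -/
def TFaceConnected (S : Finset (TPt d N)) : Prop := ∀ x ∈ S, ∀ y ∈ S, TLinked S x y

/-- A torus localization domain is `IsRConnected` for `TAdj` (the connectedness field of `B12TreeDecay.CubeSystem`). [folklore] -/
theorem isRConnected_of_tFaceConnected {S : Finset (TPt d N)} (hne : S.Nonempty) (h : TFaceConnected S) :
    IsRConnected TAdj S := by
  refine ⟨hne, fun v hv w hw => ?_⟩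
  have hl := h v hv w hw
  clear hw
  unfold TLinked at hl
  induction hl with
  | refl => exact Relation.ReflTransGen.refl
  | tail _ hbc ih => exact ih.tail ⟨hbc.2.2, hbc.1, hbc.2.1⟩

/-- Chains descend: a chain of wall-adjacent cubes inside S ⊆ ℤ^d projects to a chain inside proj(S). [folklore] -/
theorem tLinked_image {S : Finset (Pt d)} {x y : Pt d} (h : Linked S x y) :
    TLinked (S.image (proj N)) (proj N x) (proj N y) := by
  unfold Linked at h
  unfold TLinked
  induction h with
  | refl => exact Relation.ReflTransGen.refl
  | tail _ hbc ih =>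
    exact ih.tail ⟨Finset.mem_image_of_mem _ hbc.1, Finset.mem_image_of_mem _ hbc.2.1, proj_adj hbc.2.2⟩

/-- Window domains project to torus domains: the projection of a face-connected family of ℤ^d is torus-face-connected. [folklore] -/
theorem tFaceConnected_image {S : Finset (Pt d)} (h : FaceConnected S) : TFaceConnected (S.image (proj N)) := by
  intro a ha b hb
  obtain ⟨x, hx, rfl⟩ := Finset.mem_image.1 ha
  obtain ⟨y, hy, rfl⟩ := Finset.mem_image.1 hb
  exact tLinked_image (h x hx y hy)

/-- FRONTIER CUBE on the torus: if X̄ ⊆ Ȳ, X̄ is non-empty, Ȳ is a torus localization domain and Ȳ ⊄ X̄, then some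
cube of Ȳ ∖ X̄ has a common wall with a cube of X̄. [folklore] -/
theorem exists_tfrontier {X Y : Finset (TPt d N)} (hXY : X ⊆ Y) (hY : TFaceConnected Y) {x₀ y : TPt d N}
    (hx₀ : x₀ ∈ X) (hy : y ∈ Y) (hyX : y ∉ X) : ∃ a ∈ X, ∃ c ∈ Y, c ∉ X ∧ TAdj a c := by
  have key : ∀ z, TLinked Y x₀ z → z ∈ X ∨ ∃ a ∈ X, ∃ c ∈ Y, c ∉ X ∧ TAdj a c := by
    intro z hz
    unfold TLinked at hz
    induction hz with
    | refl => exact Or.inl hx₀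
    | @tail b c _ hbc ih =>
      rcases ih with hb | hfr
      · obtain ⟨-, hcY, hadj⟩ := hbc
        by_cases hc : c ∈ X
        · exact Or.inl hc
        · exact Or.inr ⟨b, hb, c, hcY, hc, hadj⟩
      · exact Or.inr hfr
  rcases key y (hY x₀ (hXY hx₀) y hy) with h | h
  · exact absurd h hyX
  · exact h

/-! ## Part 2. The linear size d_j on the torus, computed in the universal cover ℝ^d -/

/-- π⁻¹(X̄): the union of the unit cubes of ℝ^d whose index projects into X̄ — the preimage under the covering map
ℝ^d → ℝ^d/Nℤ^d of the union of the cubes of the torus family X̄ ([Balaban1987RG1] p. 257: *"every localization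
domain X is a union of continuous space cubes from π_j"*). [cite: Balaban1987RG1, p.257 (linear size d_j)] -/
def liftCubes (X : Finset (TPt d N)) : Set (RPt d) := ⋃ (x : Pt d) (_ : proj N x ∈ X), cube x

/-- Membership in `liftCubes`. [folklore] -/
theorem mem_liftCubes {X : Finset (TPt d N)} {p : RPt d} :
    p ∈ liftCubes X ↔ ∃ x : Pt d, proj N x ∈ X ∧ p ∈ cube x := by
  simp only [liftCubes, Set.mem_iUnion, exists_prop]

/-- The cubes of a family A ⊆ ℤ^d projecting into X̄ lie in π⁻¹(X̄). [folklore] -/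
theorem cubes_subset_liftCubes {A : Finset (Pt d)} {X : Finset (TPt d N)} (h : A.image (proj N) ⊆ X) :
    cubes A ⊆ liftCubes X := by
  intro p hp
  obtain ⟨x, hx, hpx⟩ := mem_cubes.1 hp
  exact mem_liftCubes.2 ⟨x, h (Finset.mem_image_of_mem _ hx), hpx⟩

/-- ADMISSIBLE GRAPHS FOR A TORUS FAMILY X̄, in the universal cover — [Balaban1987RG1] p. 257, verbatim: *"Consider a
class of tree graphs contained in X and intersecting all the cubes in X"*, X a union of cubes of the TORUS: a tree
graph of the torus lifts isometrically to ℝ^d (READING D-pv22g2.1), where it is a connected polygonal graph contained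
in π⁻¹(X) = `liftCubes X̄` which meets π⁻¹(□) — i.e. at least one lift of □ — for every cube □ of X.  Convention (ii)
of D-pv22.1 (connected finite unions of segments in place of tree graphs) as in `TreeLength.Admissible`. [cite: Balaban1987RG1, p.257 (linear size d_j)] -/
structure TAdmissible (X : Finset (TPt d N)) (T : List (Seg d)) : Prop where
  /-- the (lifted) graph is connected -/
  connected : IsConnected (carrier T)
  /-- the graph is contained in X (its lift in π⁻¹(X)) -/
  subset : carrier T ⊆ liftCubes X
  /-- the graph intersects all the cubes in X (its lift meets a lift of each) -/
  meets : ∀ a ∈ X, ∃ x : Pt d, proj N x = a ∧ (carrier T ∩ cube x).Nonempty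

/-- The set of lengths of the admissible graphs for the torus family X̄. [cite: Balaban1987RG1, p.257 (linear size d_j)] -/
def tlengths (X : Finset (TPt d N)) : Set ℝ := {ℓ | ∃ T, TAdmissible X T ∧ len T = ℓ}

/-- THE LINEAR SIZE d_j(X̄) ON THE TORUS — [Balaban1987RG1] p. 257, verbatim: *"A length of a shortest graph in this
class, divided by M, is the linear size of X, and is denoted by d_j(X). Thus we rescale the space, so that cubes from
π_j become unit cubes, and we take the distance in this scale. Let us stress the fact that we consider graphs in the
continuous space."* — as the infimum of the lengths of the `TAdmissible` graphs (unit cubes, no division by M; junk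
value `sInf ∅ = 0` for families without admissible graphs; conventions D-pv22.1, reading D-pv22g2.1). [cite: Balaban1987RG1, p.257 (linear size d_j)] -/
def torusTreeLen (X : Finset (TPt d N)) : ℝ := sInf (tlengths X)

/-- Members of `tlengths X̄` are non-negative. [folklore] -/
theorem tlengths_nonneg {X : Finset (TPt d N)} {ℓ : ℝ} (h : ℓ ∈ tlengths X) : 0 ≤ ℓ := by
  obtain ⟨T, -, rfl⟩ := h
  exact len_nonneg T

/-- `tlengths X̄` is bounded below (by 0). [folklore] -/
theorem bddBelow_tlengths (X : Finset (TPt d N)) : BddBelow (tlengths X) :=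
  ⟨0, fun _ h => tlengths_nonneg h⟩

/-- d_j(X̄) ≥ 0 on the torus. [cite: Balaban1987RG1, p.257 (linear size d_j)] -/
theorem torusTreeLen_nonneg (X : Finset (TPt d N)) : 0 ≤ torusTreeLen X :=
  Real.sInf_nonneg fun _ h => tlengths_nonneg h

/-- d_j(X̄) is at most the length of any admissible graph for X̄. [cite: Balaban1987RG1, p.257 (linear size d_j)] -/
theorem torusTreeLen_le_len {X : Finset (TPt d N)} {T : List (Seg d)} (h : TAdmissible X T) :
    torusTreeLen X ≤ len T :=
  csInf_le (bddBelow_tlengths X) ⟨T, h, rfl⟩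

/-- A lower bound of the lengths of all admissible graphs is a lower bound of d_j(X̄), provided the class is
non-empty. [folklore] -/
theorem le_torusTreeLen {X : Finset (TPt d N)} {a : ℝ} (hne : ∃ T, TAdmissible X T)
    (h : ∀ T, TAdmissible X T → a ≤ len T) : a ≤ torusTreeLen X := by
  obtain ⟨T₀, hT₀⟩ := hne
  refine le_csInf ⟨len T₀, T₀, hT₀, rfl⟩ ?_
  rintro _ ⟨T, hT, rfl⟩
  exact h T hT

/-- An admissible graph (window sense) for a family A ⊆ ℤ^d is admissible (torus sense) for its projection
X̄ = proj(A): projecting never lengthens. [folklore] -/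
theorem tAdmissible_of_admissible {A : Finset (Pt d)} {X : Finset (TPt d N)} {T : List (Seg d)}
    (hT : Admissible A T) (hA : A.image (proj N) = X) : TAdmissible X T := by
  refine ⟨hT.connected, hT.subset.trans (cubes_subset_liftCubes hA.le), ?_⟩
  intro a ha
  rw [← hA, Finset.mem_image] at ha
  obtain ⟨x, hx, rfl⟩ := ha
  exact ⟨x, rfl, hT.meets x hx⟩

/-! ## Part 3. The upper half of (2.30) on the torus: greedy lifting of a torus domain to ℤ^d -/

/-- GREEDY LIFT ([Dimock2013] Lemma 20 mechanism through the covering map): an admissible graph for A ⊆ ℤ^d with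
proj(A) ⊆ Ȳ, Ȳ a torus localization domain, extends — adjoining one lifted frontier cube at a time
(`exists_tfrontier`, `exists_lift_adj`, `TreeLength.adjoin_step`) — to an admissible graph for some A′ ⊇ A with
proj(A′) = Ȳ, at total cost ≤ |Ȳ ∖ proj(A)|. [cite: Dimock2013, §4 Lemma 20] -/
theorem exists_admissible_lift {Y : Finset (TPt d N)} (hY : TFaceConnected Y) :
    ∀ n : ℕ, ∀ (A : Finset (Pt d)) (T : List (Seg d)), A.image (proj N) ⊆ Y →
      (Y \ A.image (proj N)).card = n → Admissible A T →
      ∃ A' : Finset (Pt d), ∃ T', Admissible A' T' ∧ A'.image (proj N) = Y ∧ len T' ≤ len T + n := by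
  intro n
  induction n with
  | zero =>
    intro A T hAY hcard hT
    have hAeq : A.image (proj N) = Y :=
      Finset.Subset.antisymm hAY (Finset.sdiff_eq_empty_iff_subset.1 (Finset.card_eq_zero.1 hcard))
    exact ⟨A, T, hT, hAeq, by simp⟩
  | succ n ih =>
    intro A T hAY hcard hT
    obtain ⟨x₀, hx₀⟩ := hT.finset_nonempty
    have hne : (Y \ A.image (proj N)).Nonempty := by
      rw [← Finset.card_pos, hcard]
      exact Nat.succ_pos n
    obtain ⟨y, hy⟩ := hne
    rw [Finset.mem_sdiff] at hy
    obtain ⟨a, ha, c, hc, hcA, hac⟩ :=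
      exists_tfrontier hAY hY (Finset.mem_image_of_mem _ hx₀) hy.1 hy.2
    obtain ⟨a₀, ha₀, rfl⟩ := Finset.mem_image.1 ha
    obtain ⟨c₀, hc₀, hadj⟩ := exists_lift_adj hac
    obtain ⟨T₁, hT₁, hlen₁⟩ := adjoin_step hT ha₀ hadj
    have himg : (insert c₀ A).image (proj N) = insert c (A.image (proj N)) := by
      rw [Finset.image_insert, hc₀]
    have hsub : (insert c₀ A).image (proj N) ⊆ Y := by
      rw [himg]
      exact Finset.insert_subset hc hAY
    have hcard' : (Y \ (insert c₀ A).image (proj N)).card = n := by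
      rw [himg, Finset.sdiff_insert, Finset.card_erase_of_mem (Finset.mem_sdiff.2 ⟨hc, hcA⟩), hcard]
      simp
    obtain ⟨A', T', hT', hA', hlen'⟩ := ih (insert c₀ A) T₁ hsub hcard' hT₁
    refine ⟨A', T', hT', hA', ?_⟩
    push_cast
    linarith

section Periodic

variable [NeZero N]

/-- The standard lift (ℤ/N)^d → ℤ^d, coordinates in [0, N). [folklore] -/
def natLift (a : TPt d N) : Pt d := fun i => ((a i).val : ℤ)

/-- `natLift` is a section of `proj`. [folklore] -/
@[simp] theorem proj_natLift (a : TPt d N) : proj N (natLift a) = a := by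
  funext i
  simp [proj, natLift]

/-- Every torus localization domain Ȳ (non-empty, torus-face-connected) has an admissible graph, of length
≤ |Ȳ| − 1. [cite: Balaban1988RG2Cluster, (2.30) p.18 (upper half)] -/
theorem exists_tAdmissible {Y : Finset (TPt d N)} (hY : Y.Nonempty) (hc : TFaceConnected Y) :
    ∃ T, TAdmissible Y T ∧ len T ≤ (Y.card : ℝ) - 1 := by
  obtain ⟨a, ha⟩ := hY
  have himg : ({natLift a} : Finset (Pt d)).image (proj N) = {a} := by simp
  have hsub : ({natLift a} : Finset (Pt d)).image (proj N) ⊆ Y := by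
    rw [himg]
    exact Finset.singleton_subset_iff.2 ha
  have hcard : (Y \ ({natLift a} : Finset (Pt d)).image (proj N)).card = Y.card - 1 := by
    rw [himg, Finset.sdiff_singleton_eq_erase, Finset.card_erase_of_mem ha]
  obtain ⟨A', T', hT', hA', hlen⟩ :=
    exists_admissible_lift hc _ _ _ hsub hcard (admissible_singleton (natLift a))
  refine ⟨T', tAdmissible_of_admissible hT' hA', ?_⟩
  have h1 : 1 ≤ Y.card := Finset.card_pos.2 ⟨a, ha⟩
  have h2 : ((Y.card - 1 : ℕ) : ℝ) = Y.card - 1 := by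
    rw [Nat.cast_sub h1]
    simp
  have h3 : len [(corner (natLift a), corner (natLift a))] = 0 := by simp
  linarith

/-- (2.30) p. 18, UPPER HALF, ON THE TORUS — verbatim: *"d_k(Y) ≦ M⁻⁴|Y| − 1 (2.30) holding for localization domains
Y ∈ 𝐃_k"* — PROVED for `torusTreeLen` (M⁻⁴|Y| = the number of cubes = `Y.card`). [cite: Balaban1988RG2Cluster, (2.30) p.18 (upper half)] -/
theorem torusTreeLen_le_card_sub_one {Y : Finset (TPt d N)} (hY : Y.Nonempty) (hc : TFaceConnected Y) :
    torusTreeLen Y ≤ (Y.card : ℝ) - 1 := by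
  obtain ⟨T, hT, hlen⟩ := exists_tAdmissible hY hc
  exact (torusTreeLen_le_len hT).trans hlen

/-- A single cube of the torus has linear size 0. [cite: Balaban1987RG1, p.257 (linear size d_j)] -/
theorem torusTreeLen_singleton (a : TPt d N) : torusTreeLen ({a} : Finset (TPt d N)) = 0 := by
  refine le_antisymm ?_ (torusTreeLen_nonneg _)
  have hadm : TAdmissible ({a} : Finset (TPt d N)) [(corner (natLift a), corner (natLift a))] :=
    tAdmissible_of_admissible (admissible_singleton (natLift a)) (by simp)
  simpa using torusTreeLen_le_len hadm

omit [NeZero N] in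
/-- Projection never lengthens: for a window localization domain X ⊆ ℤ^d, the torus size of proj(X) is at most the
window size of X (every admissible graph for X is admissible for proj(X)). [folklore] -/
theorem torusTreeLen_image_le_treeLen {X : Finset (Pt d)} (hX : X.Nonempty) (hc : FaceConnected X) :
    torusTreeLen (X.image (proj N)) ≤ treeLen X := by
  refine le_treeLen ((exists_admissible hX hc).imp fun T h => h.1) ?_
  intro T hT
  exact torusTreeLen_le_len (tAdmissible_of_admissible hT rfl)

/-! ## Part 4. The lower half of (2.30) on the torus: |X̄| ≤ 2^d (4 d_j(X̄) + 1) -/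

omit [NeZero N] in
/-- THE LINEAR VOLUME BOUND FOR A GRAPH, ON THE TORUS: if T is admissible for the torus family X̄ then
|X̄| ≤ 2^d (4|T| + 1) — choose one met lift of each cube of X̄; they are |X̄| distinct cubes of ℝ^d (distinct
projections) for which T is Steiner-admissible, and `TreeLength.card_le_of_sAdmissible_len` applies. [cite: Dimock2013BalabanII, App. E Lemma E.1(3)] -/
theorem card_le_of_tAdmissible_len {X : Finset (TPt d N)} {T : List (Seg d)} (hT : TAdmissible X T) :
    (X.card : ℝ) ≤ 2 ^ d * (4 * len T + 1) := by
  classical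
  choose! f hfproj hfmeets using hT.meets
  have hinj : Set.InjOn f X := by
    intro a ha b hb hab
    rw [← hfproj a ha, ← hfproj b hb, hab]
  have hcard : (X.image f).card = X.card := Finset.card_image_of_injOn hinj
  have hS : SAdmissible (X.image f) T := by
    refine ⟨hT.connected, ?_⟩
    intro y hy
    obtain ⟨a, ha, rfl⟩ := Finset.mem_image.1 hy
    exact hfmeets a ha
  have h := card_le_of_sAdmissible_len hS
  rw [hcard] at h
  exact h

/-- (2.30) p. 18, LOWER HALF, REPAIRED (cell GAPS.md G-B13-07), ON THE TORUS: for every torus localization domain X̄,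
|X̄| ≤ 2^d (4 d_j(X̄) + 1) (d = 4: |X̄| ≤ 64 d_j(X̄) + 16). PROVED. [cite: Balaban1988RG2Cluster, (2.30) p.18 (lower half, repaired form)] -/
theorem card_le_torusTreeLen {X : Finset (TPt d N)} (hX : X.Nonempty) (hc : TFaceConnected X) :
    (X.card : ℝ) ≤ 2 ^ d * (4 * torusTreeLen X + 1) := by
  have h2d : (0 : ℝ) < 2 ^ d := by positivity
  have hne : ∃ T, TAdmissible X T := (exists_tAdmissible hX hc).imp fun T h => h.1
  have h : (X.card / 2 ^ d - 1) / 4 ≤ torusTreeLen X := by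
    refine le_torusTreeLen hne fun T hT => ?_
    have := card_le_of_tAdmissible_len hT
    rw [div_le_iff₀ (by norm_num : (0 : ℝ) < 4), sub_le_iff_le_add, div_le_iff₀ h2d]
    linarith
  rw [div_le_iff₀ (by norm_num : (0 : ℝ) < 4), sub_le_iff_le_add, div_le_iff₀ h2d] at h
  linarith

/-! ## Part 5. The torus catalogue 𝐃_j as a `LocDomainSys` and a `CubeSystem`; (1.26), `hTree`, (2.29) on the torus -/

/-- X̄ is a localization domain of the torus: a non-empty torus-face-connected family of cubes of π_j. [cite: Balaban1987RG1, p.257 (localization domains)] -/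
def IsTDom (X : Finset (TPt d N)) : Prop := X.Nonempty ∧ TFaceConnected X

/-- The type 𝐃_j of localization domains of the torus with N cubes per direction. [cite: Balaban1987RG1, p.257 (localization domains)] -/
def TDom (d N : ℕ) [NeZero N] : Type := {X : Finset (TPt d N) // IsTDom X}

/-- 𝐃_j is a finite type (π_j is finite). [folklore] -/
instance instFintypeTDom (d N : ℕ) [NeZero N] : Fintype (TDom d N) := by
  classical
  exact Fintype.subtype ((Finset.univ : Finset (Finset (TPt d N))).filter fun X => X.Nonempty ∧ TFaceConnected X)
    fun X => by simp only [Finset.mem_filter, Finset.mem_univ, true_and, IsTDom]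

/-- THE CONCRETE `LocDomainSys` OF THE TORUS: domains = 𝐃_j of the torus with N cubes per direction,
d_j := `torusTreeLen` (≥ 0 by `torusTreeLen_nonneg`). [cite: Balaban1987RG1, p.257 (localization domains)] -/
def tsys (d N : ℕ) [NeZero N] : LocDomainSys where
  Dom := TDom d N
  dj := fun X => torusTreeLen X.1
  dj_nonneg := fun X => torusTreeLen_nonneg X.1

/-- The tree length of the torus system is `torusTreeLen`. [folklore] -/
@[simp] theorem tsys_dj (d N : ℕ) [NeZero N] (X : (tsys d N).Dom) : (tsys d N).dj X = torusTreeLen X.1 := rfl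

/-- The wall-neighbours of a cube of the torus, as a finite list. [folklore] -/
def tnbr (a : TPt d N) : Finset (TPt d N) := by
  classical
  exact Finset.univ.filter fun b => TAdj a b

/-- Membership in `tnbr`. [folklore] -/
@[simp] theorem mem_tnbr {a b : TPt d N} : b ∈ tnbr a ↔ TAdj a b := by
  classical
  simp [tnbr]

/-- THE CONCRETE `CubeSystem` OF THE TORUS over `tsys d N`: cubes = (ℤ/N)^d, adjacency = common wall on the torus
(`TAdj`), neighbour lists `tnbr`, cubes of a domain = its members, connectedness from `TFaceConnected`. [cite: Balaban1987RG1, p.257 (localization domains)] -/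
def tcubeSys (d N : ℕ) [NeZero N] : CubeSystem (tsys d N) where
  Cube := TPt d N
  Adj := TAdj
  adj_symm := fun _ _ h => h.symm
  nbr := tnbr
  mem_nbr := fun _ _ h => mem_tnbr.2 h
  cubes := fun X => X.1
  cubes_injective := fun _ _ h => Subtype.ext h
  connected := fun X => isRConnected_of_tFaceConnected X.2.1 X.2.2

/-- The cubes of a domain in the torus system are its members. [folklore] -/
@[simp] theorem tcubeSys_cubes (d N : ℕ) [NeZero N] (X : (tsys d N).Dom) : (tcubeSys d N).cubes X = X.1 := rfl

/-- The volume |X̄|_M of a domain in the torus system is its number of cubes. [folklore] -/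
theorem tcubeSys_vol (d N : ℕ) [NeZero N] (X : (tsys d N).Dom) : (tcubeSys d N).vol X = X.1.card := rfl

/-- DEGREE BOUND ON THE TORUS, PROVED: every cube of π_j has at most 2d wall-neighbours
(`B12TreeDecay.CubeSystem.DegreeLE (2 * d)`). [cite: Dimock2013, App. A Lemma 25 proof (arXiv:1108.1335v2 TeX L3119–3120)] -/
theorem tdegreeLE (d N : ℕ) [NeZero N] : (tcubeSys d N).DegreeLE (2 * d) := by
  classical
  intro a
  show (tnbr a).card ≤ 2 * d
  have hsub : tnbr a ⊆ Finset.univ.image (tshift a) := by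
    intro b hb
    obtain ⟨p, hp⟩ := exists_tshift_of_tadj (mem_tnbr.1 hb)
    exact Finset.mem_image.2 ⟨p, Finset.mem_univ _, hp.symm⟩
  calc (tnbr a).card ≤ (Finset.univ.image (tshift a)).card := Finset.card_le_card hsub
    _ ≤ (Finset.univ : Finset (Fin d × Bool)).card := Finset.card_image_le
    _ = 2 * d := by simp [Finset.card_univ, mul_comm]

/-- THE VOLUME LEAF ON THE TORUS, PROVED: |X̄| ≤ 4·2^d (1 + d_j(X̄)) for every torus localization domain
(`B12TreeDecay.CubeSystem.VolumeLeaf (4 * 2 ^ d)`), from `card_le_torusTreeLen`. [cite: Balaban1988RG2Cluster, (2.30) p.18 (lower half, repaired form)] -/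
theorem tvolumeLeaf (d N : ℕ) [NeZero N] : (tcubeSys d N).VolumeLeaf (4 * 2 ^ d) := by
  intro X
  rw [tcubeSys_vol, tsys_dj]
  have h := card_le_torusTreeLen X.2.1 X.2.2
  have h2 : (0 : ℝ) ≤ 2 ^ d := by positivity
  nlinarith

/-- **[Balaban1988RG2Cluster] (1.26) p. 8 ON THE TORUS, NO HYPOTHESES ON THE GEOMETRY**: for every d, N, every
κ ≥ κ₀(4·2^d, 2d) and every cube □′ of π_j, Σ_{X ∈ 𝐃_j, X ∋ □′} exp(−κ d_j(X)) ≤ K₀(4·2^d, 2d).  Application of unit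
pv03's `ineq126_of_volumeLeaf` to `tdegreeLE`, `tvolumeLeaf`. [cite: Balaban1988RG2Cluster, (1.26) p.8] -/
theorem ineq126_torus (d N : ℕ) [NeZero N] {κ : ℝ} (hκ : kappa₀ (4 * 2 ^ d) (2 * d) ≤ κ) :
    (tcubeSys d N).Ineq126Printed κ (K₀ (4 * 2 ^ d) (2 * d)) :=
  ineq126_of_volumeLeaf (tcubeSys d N) (tdegreeLE d N) (tvolumeLeaf d N) hκ

/-- (1.26) on the torus spelled out over plain finite sets: for every cube □′ ∈ π_j and every κ ≥ κ₀(4·2^d, 2d), the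
sum of exp(−κ·d_j(X̄)) over the torus-face-connected X̄ ∋ □′ is ≤ K₀(4·2^d, 2d). [cite: Balaban1988RG2Cluster, (1.26) p.8] -/
theorem sum_exp_torusTreeLen_le (d N : ℕ) [NeZero N] (c : TPt d N) {κ : ℝ}
    (hκ : kappa₀ (4 * 2 ^ d) (2 * d) ≤ κ) [DecidablePred fun X : Finset (TPt d N) => c ∈ X ∧ TFaceConnected X] :
    ∑ X ∈ (Finset.univ : Finset (Finset (TPt d N))).filter (fun X => c ∈ X ∧ TFaceConnected X),
      Real.exp (-κ * torusTreeLen X) ≤ K₀ (4 * 2 ^ d) (2 * d) := by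
  classical
  have h := ineq126_torus d N hκ c
  have heq : ∑ X ∈ (tcubeSys d N).above c, Real.exp (-κ * (tsys d N).dj X)
      = ∑ X ∈ (Finset.univ : Finset (Finset (TPt d N))).filter (fun X => c ∈ X ∧ TFaceConnected X),
          Real.exp (-κ * torusTreeLen X) := by
    refine Finset.sum_bij (fun X _ => X.1) ?_ ?_ ?_ ?_
    · intro X hX
      rw [CubeSystem.mem_above, tcubeSys_cubes] at hX
      rw [Finset.mem_filter]
      exact ⟨Finset.mem_univ _, hX, X.2.2⟩
    · intro X _ Y _ h
      exact Subtype.ext h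
    · intro Y hY
      rw [Finset.mem_filter] at hY
      refine ⟨⟨Y, ⟨c, hY.2.1⟩, hY.2.2⟩, ?_, rfl⟩
      rw [CubeSystem.mem_above, tcubeSys_cubes]
      exact hY.2.1
    · intro X _
      rfl
  rw [← heq]
  exact h

/-- The silent input `hTree` of [Balaban1987RG1] (0.26)/(0.30) (surge node T09.1; cell GAPS.md G-pv03-1) for the cover
induced by the torus system, DISCHARGED outright: `∀ □, Σ_{X ∈ above □} exp(−κ d_j(X)) ≤ K₀` for κ ≥ κ₀. [cite: Balaban1987RG1, (0.26) p.257 and (0.30) p.258] -/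
theorem hTree_torus (d N : ℕ) [NeZero N] {κ : ℝ} (hκ : kappa₀ (4 * 2 ^ d) (2 * d) ≤ κ) :
    ∀ c : (tcubeSys d N).toCubeCover.Cube,
      ∑ X ∈ (tcubeSys d N).toCubeCover.above c, Real.exp (-κ * (tsys d N).dj X) ≤ K₀ (4 * 2 ^ d) (2 * d) :=
  hTree_of_volumeLeaf (tcubeSys d N) (tdegreeLE d N) (tvolumeLeaf d N) hκ

/-- The multi-scale form of `hTree` for a family of tori (N_j cubes per direction at scale j), same constants at every
scale. [cite: Balaban1987RG1, (0.26) p.257 and (0.30) p.258] -/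
theorem hTree_scales_torus (d k : ℕ) (Nc : ℕ → ℕ) [∀ j, NeZero (Nc j)] {κ : ℝ}
    (hκ : kappa₀ (4 * 2 ^ d) (2 * d) ≤ κ) :
    ∀ j ∈ Finset.Icc 1 k, ∀ c : (tcubeSys d (Nc j)).toCubeCover.Cube,
      ∑ X ∈ (tcubeSys d (Nc j)).toCubeCover.above c, Real.exp (-κ * (tsys d (Nc j)).dj X)
        ≤ K₀ (4 * 2 ^ d) (2 * d) :=
  hTree_scales_of_volumeLeaf k (fun j => tsys d (Nc j)) (fun j => tcubeSys d (Nc j)) (fun j => tdegreeLE d (Nc j))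
    (fun j => tvolumeLeaf d (Nc j)) hκ

/-- **[Balaban1988RG2Cluster] (2.29) p. 18 ON THE TORUS, NO HYPOTHESES ON THE GEOMETRY**: with c₀ = 4·2^d, Δ = 2d
and the smallness conditions of `B12TreeDecay.ineq229_of_volumeLeaf` (α₆ ≥ 0, a₂ ≥ 0, δκ ≥ κ₀(c₀, Δ) + a₂,
α₆ e^{a₂} K₀(c₀, Δ) c₀ ≤ a₂): Σ_𝐃 Π_{Y∈𝐃} α₆ exp(−δκ d_k(Y)) ≤ 1 for EVERY Y₀, the sum over the families 𝐃 of
different torus localization domains with ∪𝐃 = Y₀ (`B13FamilySum.Ineq229`, unit pv18). [cite: Balaban1988RG2Cluster, (2.29) p.18] -/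
theorem ineq229_torus (d N : ℕ) [NeZero N] (δ κ α₆ a₂ : ℝ) (hα₆ : 0 ≤ α₆) (ha₂ : 0 ≤ a₂)
    (hκ : kappa₀ (4 * 2 ^ d) (2 * d) + a₂ ≤ δ * κ)
    (hsmall : α₆ * Real.exp a₂ * K₀ (4 * 2 ^ d) (2 * d) * (4 * 2 ^ d) ≤ a₂) :
    B13FamilySum.Ineq229 (Finset.univ : Finset (tsys d N).Dom) (tcubeSys d N).cubes (tsys d N).dj α₆ (δ * κ) :=
  ineq229_of_volumeLeaf (tcubeSys d N) (tdegreeLE d N) (by positivity) (tvolumeLeaf d N) δ κ α₆ a₂ hα₆ ha₂ hκ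
    hsmall

/-- The unit instance of (2.29) on the torus (a₂ = 1): δκ ≥ κ₀(4·2^d, 2d) + 1 and e·K₀(4·2^d, 2d)·4·2^d·α₆ ≤ 1
suffice. [cite: Balaban1988RG2Cluster, (2.29) p.18] -/
theorem ineq229_torus_unit (d N : ℕ) [NeZero N] (δ κ α₆ : ℝ) (hα₆ : 0 ≤ α₆)
    (hκ : kappa₀ (4 * 2 ^ d) (2 * d) + 1 ≤ δ * κ)
    (hsmall : Real.exp 1 * K₀ (4 * 2 ^ d) (2 * d) * (4 * 2 ^ d) * α₆ ≤ 1) :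
    B13FamilySum.Ineq229 (Finset.univ : Finset (tsys d N).Dom) (tcubeSys d N).cubes (tsys d N).dj α₆ (δ * κ) :=
  ineq229_of_volumeLeaf_unit (tcubeSys d N) (tdegreeLE d N) (by positivity) (tvolumeLeaf d N) δ κ α₆ hα₆ hκ
    hsmall

/-! ## Part 6. The counts: |π_j| = N^d = M^{−d}(MN)^d, the site counts of `Setup`, and T09.1 on the torus -/

/-- |π_j| = N^d for the torus with N cubes per direction. [folklore] -/
theorem card_tpt (d N : ℕ) [NeZero N] : Fintype.card (TPt d N) = N ^ d := by
  simp [Fintype.card_pi, ZMod.card, Finset.prod_const]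

/-- The cube type of the torus system has N^d elements. [folklore] -/
theorem card_tcube (d N : ℕ) [NeZero N] : Fintype.card (tcubeSys d N).Cube = N ^ d :=
  card_tpt d N

/-- The shape of the input `hπ` of `B12TreeDecay.uvStable030_of_thm1_of_volumeLeaf` — [Balaban1987RG1] (0.26)
p. 257: *"Σ_{□∈π_j} E₀O(1) = … E₀O(1)M^{−4}|T_1^{(j)}|"*, i.e. |π_j| = M^{−d}|T_1^{(j)}| when the cubes of side M
tile a torus of M·N sites per direction: N^d = M^{−d}(MN)^d. [cite: Balaban1987RG1, (0.26) p.257] -/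
theorem card_tcube_eq_inv_pow (d N : ℕ) [NeZero N] {M : ℝ} (hM : M ≠ 0) :
    (Fintype.card (tcubeSys d N).Cube : ℝ) = M⁻¹ ^ d * (M * N) ^ d := by
  rw [card_tcube]
  push_cast
  rw [mul_pow, ← mul_assoc, ← mul_pow, inv_mul_cancel₀ hM, one_pow, one_mul]

/-- The site-count identity of the periodic lattices of `Setup` (sites per direction of T^{(j)} = 2L^{m+K−j}): for
j ≤ k ≤ m + K, |T^{(j)}| per direction = L^{k−j} · |T^{(k)}| per direction — the identity behind (0.26) p. 257
*"Σ_{j=1}^{k} E₀O(1)M^{−4}|T_1^{(j)}| ≦ E₀O(1)M^{−4}|T_1^{(k)}|η^{−4}, η = L^{−k}"*. [cite: Balaban1987RG1, (0.1) p.251] -/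
theorem sitesPerDir_eq_pow_mul (P : Params) {j k : ℕ} (hjk : j ≤ k) (hk : k ≤ P.m + P.K) :
    P.sitesPerDir j = P.L ^ (k - j) * P.sitesPerDir k := by
  unfold Params.sitesPerDir
  have h : P.m + P.K - j = (k - j) + (P.m + P.K - k) := by omega
  rw [h, pow_add]
  ring

/-- The shape of the input `hSites` of `B12TreeDecay.uvStable030_of_thm1_of_volumeLeaf` for the periodic lattices of
`Setup`: |T_1^{(j)}| = (L^{k−j})^n |T_1^{(k)}| with |T_1^{(j)}| = (sites per direction)^n, j ≤ k ≤ m + K. [cite: Balaban1987RG1, (0.26) p.257] -/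
theorem sitesPerDir_pow_eq (P : Params) (n : ℕ) {j k : ℕ} (hjk : j ≤ k) (hk : k ≤ P.m + P.K) :
    ((P.sitesPerDir j : ℕ) : ℝ) ^ n = ((P.L : ℝ) ^ (k - j)) ^ n * ((P.sitesPerDir k : ℕ) : ℝ) ^ n := by
  rw [sitesPerDir_eq_pow_mul P hjk hk]
  push_cast
  ring

/-- **T09.1 ON THE TORUS — `B12TreeDecay.uvStable030_of_thm1_of_volumeLeaf` (d = 4) with the localization domains of
every scale of every run realised as the TORUS catalogues `tsys 4 (N P j)` (N P j cubes of π_j per direction)**: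
Theorem 1 (`B12.Thm1Printed`) ⟹ ultraviolet stability (0.30) (`B12.UVStable030`) with the constant
O(1)·K₀(64, 8)·(1 − L^{−α})^{−1}, for every κ ≥ κ₀(64, 8) = 64 log 162; the geometric inputs `hΔ`, `hV` of that
theorem are DISCHARGED (`tdegreeLE`, `tvolumeLeaf`) and its cube count `hπ` is REPLACED by the tiling identity
`hnum` : |T_1^{(j)}| = (M·N_j)^4 ([Balaban1987RG1] p. 257: *"closed cubes of a size M, where M = L^m, with centers at
points of the lattice T_M^{(j+m)}"* — M = L^{m'}, T_M^{(j+m')} in the vocabulary of NOTATION.md §2.4 — and (0.26):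
|π_j| = M^{−4}|T_1^{(j)}|); the readings `h023`, `h028`, `h029` of `Repr` and `hSites` stay as in surge node T09.1.
Pure composition. [cite: Balaban1987RG1, (0.30) p.258 and p.259] -/
theorem uvStable030_of_thm1_torus (C : B12.Construction) (O1 α κ M L : ℝ) (Nc : B12.RunParams → ℕ → ℕ)
    [∀ P j, NeZero (Nc P j)]
    (hO1 : 0 ≤ O1) (hα : 0 < α) (hM : 0 < M) (hL : 1 < L) (hκ : kappa₀ (4 * 2 ^ 4) (2 * 4) ≤ κ)
    (Etot : (P : B12.RunParams) → (k : ℕ) → (C P).Cfg k → ℕ → ℝ)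
    (VX : (P : B12.RunParams) → (k : ℕ) → (C P).Cfg k → (j : ℕ) → (tsys 4 (Nc P j)).Dom → ℝ)
    (h1 : B12.Thm1Printed C)
    (h023 : ∀ P k, (C P).Repr k → ∀ V, V ∈ (C P).dom k →
      B12.Sum023Printed ((C P).Ek k V) ((C P).wilsonBG k V) (fun j => (C P).flow.β j ((C P).flow.g (j - 1)))
        (Etot P k V) k)
    (h028 : ∀ P k, (C P).Repr k → ∀ V, V ∈ (C P).dom k → ∀ j ∈ Finset.Icc 1 k,
      B12.Sum028Printed ((C P).flow.β j ((C P).flow.g (j - 1))) ((C P).wilsonBG k V) (Etot P k V j) (VX P k V j))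
    (h029 : ∀ P k, (C P).Repr k → ∀ V, V ∈ (C P).dom k → ∀ j ∈ Finset.Icc 1 k,
      B12.Bound029Printed (VX P k V j) O1 L ((L ^ k)⁻¹) α κ j)
    (hnum : ∀ P j, ((C P).numSites j : ℝ) = (M * (Nc P j : ℝ)) ^ 4)
    (hSites : ∀ P j k, j ≤ k → k ≤ P.K →
      ((C P).numSites j : ℝ) = (L ^ (k - j)) ^ 4 * ((C P).numSites k : ℝ)) :
    ∃ γ : ℝ, 0 < γ ∧ B12.UVStable030 C γ (O1 * K₀ (4 * 2 ^ 4) (2 * 4) * (1 - L ^ (-α))⁻¹) M :=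
  uvStable030_of_thm1_of_volumeLeaf C O1 α κ M L (4 * 2 ^ 4) (2 * 4) hO1 hα hM hL hκ
    (fun P j => tsys 4 (Nc P j)) (fun P j => tcubeSys 4 (Nc P j)) (fun P j => tdegreeLE 4 (Nc P j))
    (fun P j => tvolumeLeaf 4 (Nc P j)) Etot VX h1 h023 h028 h029
    (fun P j => by rw [hnum P j]; exact card_tcube_eq_inv_pow 4 (Nc P j) hM.ne')
    hSites

end Periodic

end

end Literature.MathematicalPhysics.QuantumFieldTheory.Balaban1983to89.TreeLengthTorus
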